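import Mathlib
import HarnessLib
import Summits.HubbardSuperconductivity.HubbardSuperconductivity.Theses.ChiralWindow

/-!
# Certificate vocabulary for the crux `CwKLChiralWindow` (route `ChiralWindow`, line `Sketch`)

Crux item stmt-HubbardSuperconductivity-1741, decl
`Summit.HubbardSuperconductivity.HubbardSuperconductivity.Theses.ChiralWindow.CwKLChiralWindow` (certified
Kohn–Luttinger chiral-window data).  The line closes the crux from a `U = 1` statement about the five channel
bottoms `channelInf ε₀ μ 1 χ` on a window of chemical potentials `μ ∈ [μ_b, μ_a]` (skeleton v5,
`Cruxes/CwKLChiralWindow/Lines/Sketch.lean`).  That statement is discharged by CERTIFICATE LOGIC (Ritz upper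
bounds, Temple lower bounds with a negative-square-mass level — `Literature.Analysis.OperatorTheory.TempleCertificate`
— and Kato's eigenvector enclosure for the node covering) over a finite RATIONAL record, plus ENCLOSURES of
finitely many explicit integrals certified by interval arithmetic (the `ccert` seat; interface
`Cruxes/CwKLChiralWindow/CertInterface.md`).  This file only NAMES these objects; nothing is proved here:

* `KLTrig` — a trigonometric polynomial of the polar angle with rational coefficients (the trial and
  deflation functions), `KLTrig.eval`, `KLTrig.toFun` (value `0` at the origin, as in
  `Literature…inChannel_radialTransport`), `KLTrig.fits χ` (the harmonic pattern making it a channel-`χ`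
  function: `A1g` cos `4ℤ`, `A2g` sin `4ℤ`, `B1g` cos `4ℤ+2`, `B2g` sin `4ℤ+2`, `E` odd);
* `KLBlock` — per channel and box: trial (index into the record's table `trials`), enclosure bounds `Nlo ≤ ∫Φ² ≤ Nhi`, `Qlo ≤ ⟨Φ, KΦ⟩ ≤ Qhi`,
  `‖KΦ‖² ≤ Thi`, a positive finite-rank deflation `Σ c_m u_m ⊗ u_m`, the deflated sector square mass bound
  `Hhi`, the Temple level `beta`, the far-channel bound `s`, and the flag `withU` (kernel `1 + χ₀` for `A1g`);
  `KLBlock.Enclosure μ χ` — the enclosure statements E1–E4 of the interface as a `Prop`;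
* `KLBox` (a `μ`-box with its five blocks and the node data `R2, pB, pE, r1B, r2B, r1E, r2E`),
  `KLBox.NodeEnclosure` (E5–E6), `KLCert` (window ends, margin `gamma`, cover constant `cov`, the table of
  trigonometric polynomials, boxes) and
  `KLCert.Enclosures` — **the named numerical hypothesis** (E0–E6 on every box, uniformly in `μ`);
* the kernel-decidable checker `KLCert.check` (rational Temple/Ritz/Kato bookkeeping, clause and cover checks),
  whose soundness `KLCert.Enclosures c → c.check = true → (μ-form clauses)` is proved in the companion
  Theorems files.

Design: all record entries are `ℚ` (dyadic in practice) so that `c.check = true` is decided by `decide +kernel`;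
real semantics only in the `Prop`s.  Junk: `KLTrig.toFun 0 = 0` (documented device); empty coefficient lists are
the zero function; a block with `useTrial = false` ignores its trial fields.  References: Reed–Simon IV Thm. XIII.5
(Temple), Kato *Perturbation theory* §VI.4, RKS 2010 §II (the kernel), the tree's `TempleCertificate`.
-/

noncomputable section

namespace Summit.HubbardSuperconductivity.HubbardSuperconductivity.Theorems.CwKLChiralWindow

set_option linter.dupNamespace false -- summit = problem name (single-conjunct summit), D-0017

open MeasureTheory Literature.MathematicalPhysics.QuantumLattice

/-! ### Trigonometric polynomials of the polar angle -/

/-- A real trigonometric polynomial of the polar angle with rational coefficients: lists of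
`(frequency, coefficient)` for the cosines and for the sines (repetitions add up). [folklore] -/
structure KLTrig where
  /-- cosine terms `(j, a)` standing for `a cos (j θ)` -/
  cosC : List (ℕ × ℚ)
  /-- sine terms `(j, b)` standing for `b sin (j θ)` -/
  sinC : List (ℕ × ℚ)

namespace KLTrig

/-- The value `Σ a_j cos (j θ) + Σ b_j sin (j θ)` at the angle `θ`. [folklore] -/
def eval (t : KLTrig) (θ : ℝ) : ℝ :=
  (t.cosC.map fun p : ℕ × ℚ => (p.2 : ℝ) * Real.cos ((p.1 : ℝ) * θ)).sum +
    (t.sinC.map fun p : ℕ × ℚ => (p.2 : ℝ) * Real.sin ((p.1 : ℝ) * θ)).sum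

open scoped Classical in
/-- The trigonometric polynomial as a gap function on momentum space: the value at the polar angle
`arg (k₀ + i k₁) ∈ (-π, π]` of `k`, and `0` at the origin (where the angle is not `D₄`-equivariant; the
origin is not on any Fermi curve of the window). [folklore] -/
def toFun (t : KLTrig) (k : Momentum) : ℝ :=
  if k = 0 then 0 else t.eval (Complex.arg ⟨k 0, k 1⟩)

/-- The harmonic pattern that places the trigonometric polynomial in the symmetry channel `χ` of `D₄`:
`A1g`: cosines of frequency `≡ 0 (mod 4)` only; `A2g`: sines of frequency `≡ 0 (mod 4)` only; `B1g`: cosines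
`≡ 2 (mod 4)`; `B2g`: sines `≡ 2 (mod 4)`; `E`: odd frequencies (cosines and sines). [folklore] -/
def fits (t : KLTrig) : D4Irrep → Bool
  | .A1g => (t.cosC.all fun p => p.1 % 4 == 0) && t.sinC.isEmpty
  | .A2g => (t.sinC.all fun p => p.1 % 4 == 0) && t.cosC.isEmpty
  | .B1g => (t.cosC.all fun p => p.1 % 4 == 2) && t.sinC.isEmpty
  | .B2g => (t.sinC.all fun p => p.1 % 4 == 2) && t.cosC.isEmpty
  | .E => (t.cosC.all fun p => p.1 % 2 == 1) && (t.sinC.all fun p => p.1 % 2 == 1)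

end KLTrig

/-! ### Channel blocks, boxes, the record -/

/-- The certificate data of one symmetry channel on one `μ`-box: an optional trial function (an index into the
record's table of trigonometric polynomials) with enclosures of its norm (`Nlo, Nhi`), Rayleigh numerator
(`Qlo, Qhi`) and image norm (`Thi`), a positive finite-rank deflation `Σ_m c_m u_m ⊗ u_m` of the sector kernel
(weights and table indices) with the bound `Hhi` on the deflated Hilbert–Schmidt square mass, the Temple level
`beta ≤ 0`, the far-channel bound `s` (`bottom ≥ -s` when no trial is used), and `withU` (use the full `U = 1` kernel
`1 + χ₀(k+k')`; meaningful for `A1g`). [folklore] -/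
structure KLBlock where
  /-- whether the trial function and its enclosures are to be used (Ritz/Temple) -/
  useTrial : Bool
  /-- the trial function (index into `KLCert.trials`) -/
  trial : ℕ
  /-- lower bound for `∫ Φ² dσ_μ` -/
  Nlo : ℚ
  /-- upper bound for `∫ Φ² dσ_μ` -/
  Nhi : ℚ
  /-- lower bound for `∫ Φ (K Φ) dσ_μ` -/
  Qlo : ℚ
  /-- upper bound for `∫ Φ (K Φ) dσ_μ` -/
  Qhi : ℚ
  /-- upper bound for `∫ (K Φ)² dσ_μ` -/
  Thi : ℚ
  /-- the deflation terms `(c_m, index of u_m)` -/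
  defl : List (ℚ × ℕ)
  /-- upper bound for the deflated sector square mass `∫∫ (K_χ - Σ c u⊗u)²` -/
  Hhi : ℚ
  /-- the Temple level (second negative level bound), `≤ 0` -/
  beta : ℚ
  /-- far-channel bound: bottom `≥ -s` -/
  s : ℚ
  /-- base kernel `1 + χ₀` instead of `χ₀` -/
  withU : Bool

/-- Reading the table of trigonometric polynomials (the zero polynomial beyond its end). [folklore] -/
def klTab (tab : List KLTrig) (i : ℕ) : KLTrig := tab.getD i ⟨[], []⟩

namespace KLBlock

/-- The trial function of the block (from the table `tab`). [folklore] -/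
def trialFun (b : KLBlock) (tab : List KLTrig) : Momentum → ℝ := (klTab tab b.trial).toFun

/-- The base kernel of the block: `χ₀(k + q; μ)`, plus the bare-`U = 1` constant `1` if `withU`. [folklore] -/
def baseKernel (b : KLBlock) (μ : ℝ) (k q : Momentum) : ℝ :=
  (if b.withU then 1 else 0) + lindhardFunction (squareDispersion 1 0) μ (k + q)

/-- The sector kernel `K_χ(k, k') = (dim χ / 8) Σ_g χ(g) κ(k, g k')` (the kernel of `A ∘ P_χ`), `κ` the base kernel.
[folklore] -/
def sectorKernel (b : KLBlock) (μ : ℝ) (χ : D4Irrep) (k k' : Momentum) : ℝ :=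
  d4Project χ (fun q => b.baseKernel μ k q) k'

/-- The deflation kernel `Σ_m c_m u_m(k) u_m(k')` (vectors from the table `tab`). [folklore] -/
def deflKernel (b : KLBlock) (tab : List KLTrig) (k k' : Momentum) : ℝ :=
  (b.defl.map fun d : ℚ × ℕ => (d.1 : ℝ) * ((klTab tab d.2).toFun k * (klTab tab d.2).toFun k')).sum

/-- **The enclosure statements of a block** at the level `μ` in the channel `χ` (interface E1–E4): with
`σ = σ_μ`, `Φ` the trial, `F(k) = ∫ κ(k,k') Φ(k') dσ`: if the trial is used then `Nlo ≤ ∫Φ² ≤ Nhi`,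
`Qlo ≤ ∫ Φ F ≤ Qhi`, `∫ F² ≤ Thi`; and always `∫∫ (K_χ - Σ c u⊗u)² d(σ⊗σ) ≤ Hhi`. [folklore] -/
def Enclosure (b : KLBlock) (tab : List KLTrig) (μ : ℝ) (χ : D4Irrep) : Prop :=
  (b.useTrial = true →
    (b.Nlo : ℝ) ≤ ∫ k, b.trialFun tab k ^ 2 ∂fermiCurveMeasure (squareDispersion 1 0) μ ∧
    ∫ k, b.trialFun tab k ^ 2 ∂fermiCurveMeasure (squareDispersion 1 0) μ ≤ (b.Nhi : ℝ) ∧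
    (b.Qlo : ℝ) ≤ ∫ k, b.trialFun tab k *
        ∫ k', b.baseKernel μ k k' * b.trialFun tab k' ∂fermiCurveMeasure (squareDispersion 1 0) μ
        ∂fermiCurveMeasure (squareDispersion 1 0) μ ∧
    ∫ k, b.trialFun tab k *
        ∫ k', b.baseKernel μ k k' * b.trialFun tab k' ∂fermiCurveMeasure (squareDispersion 1 0) μ
        ∂fermiCurveMeasure (squareDispersion 1 0) μ ≤ (b.Qhi : ℝ) ∧
    ∫ k, (∫ k', b.baseKernel μ k k' * b.trialFun tab k' ∂fermiCurveMeasure (squareDispersion 1 0) μ) ^ 2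
        ∂fermiCurveMeasure (squareDispersion 1 0) μ ≤ (b.Thi : ℝ)) ∧
  ∫ z, (b.sectorKernel μ χ z.1 z.2 - b.deflKernel tab z.1 z.2) ^ 2
      ∂(fermiCurveMeasure (squareDispersion 1 0) μ).prod (fermiCurveMeasure (squareDispersion 1 0) μ) ≤ (b.Hhi : ℝ)

/-! #### The rational bookkeeping of a block -/

/-- Upper end of the Rayleigh-quotient enclosure `Q/N ≤ max (Qhi/Nlo) (Qhi/Nhi)`. [folklore] -/
def rhohi (b : KLBlock) : ℚ := max (b.Qhi / b.Nlo) (b.Qhi / b.Nhi)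

/-- Lower end of the Rayleigh-quotient enclosure `min (Qlo/Nlo) (Qlo/Nhi) ≤ Q/N`. [folklore] -/
def rholo (b : KLBlock) : ℚ := min (b.Qlo / b.Nlo) (b.Qlo / b.Nhi)

/-- Upper bound `Thi / Nlo` for the normalised image norm `‖K Φ̂‖²`. [folklore] -/
def alpha (b : KLBlock) : ℚ := b.Thi / b.Nlo

/-- The Temple certificate function `(β ρ - α)/(β - ρ)`. [cite: ReedSimonIV1978, Thm. XIII.5] -/
def temple (b : KLBlock) (ρ : ℚ) : ℚ := (b.beta * ρ - b.alpha) / (b.beta - ρ)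

/-- Multiplicity of negative eigenvalues forced by symmetry: `2` for the doublet `E`, else `1`. [folklore] -/
def dmult (χ : D4Irrep) : ℚ := if χ = D4Irrep.E then 2 else 1

/-- The deflation is admissible: non-negative weights, vectors in the sector. [folklore] -/
def deflOK (b : KLBlock) (tab : List KLTrig) (χ : D4Irrep) : Bool :=
  b.defl.all fun d => decide (0 ≤ d.1) && decide (d.2 < tab.length) && (klTab tab d.2).fits χ

/-- The Ritz data are usable: trial in the sector, positive norm enclosure, negative Rayleigh quotient,
`withU` only for `A1g`. [folklore] -/
def ritzOK (b : KLBlock) (tab : List KLTrig) (χ : D4Irrep) : Bool :=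
  b.useTrial && decide (b.trial < tab.length) && (klTab tab b.trial).fits χ && decide (0 < b.Nlo) && decide (b.Nlo ≤ b.Nhi) && decide (b.Qlo ≤ b.Qhi) &&
    decide (b.Qhi < 0) && (!b.withU || decide (χ = D4Irrep.A1g))

/-- The Temple data are usable: Ritz data, admissible deflation, `beta ≤ 0`, `Hhi - d ρhi² ≤ beta²`, `ρhi < beta`.
[cite: ReedSimonIV1978, Thm. XIII.5] -/
def templeOK (b : KLBlock) (tab : List KLTrig) (χ : D4Irrep) : Bool :=
  b.ritzOK tab χ && b.deflOK tab χ && decide (0 ≤ b.Thi) && decide (b.beta ≤ 0) &&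
    decide (b.Hhi - dmult χ * b.rhohi ^ 2 ≤ b.beta ^ 2) && decide (b.rhohi < b.beta)

/-- The far-channel data are usable: admissible deflation, `0 ≤ s`, `Hhi ≤ s²`, `withU` only for `A1g`. [folklore] -/
def farOK (b : KLBlock) (tab : List KLTrig) (χ : D4Irrep) : Bool :=
  b.deflOK tab χ && decide (0 ≤ b.s) && decide (b.Hhi ≤ b.s ^ 2) && (!b.withU || decide (χ = D4Irrep.A1g))

/-- A certified lower bound for the channel bottom is available. [folklore] -/
def lowerOK (b : KLBlock) (tab : List KLTrig) (χ : D4Irrep) : Bool := b.templeOK tab χ || b.farOK tab χ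

/-- The certified lower bound: Temple's `min (f ρlo) (f ρhi)` if available, else `-s`. [folklore] -/
def lower (b : KLBlock) (tab : List KLTrig) (χ : D4Irrep) : ℚ :=
  if b.templeOK tab χ then min (b.temple b.rholo) (b.temple b.rhohi) else -b.s

/-- The certified (Ritz) upper bound `ρhi` for the channel bottom. [folklore] -/
def upper (b : KLBlock) : ℚ := b.rhohi

/-- Kato's squared distance bound `(α - ρhi²)/(β - ρhi)²` of the normalised trial to the bottom eigenspace.
[folklore] -/
def kato (b : KLBlock) : ℚ := (b.alpha - b.rhohi ^ 2) / (b.beta - b.rhohi) ^ 2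

end KLBlock

/-- The certificate data of one `μ`-box `[mulo, muhi]`: the five channel blocks and the node-covering data
(`R2` row bound of `χ₀`, thresholds `pB, pE` for the trial amplitudes, and rational square-root witnesses
`r1B ≥ √(R2·kato_B)`, `r2B ≤ √(pB/Nhi_B)`, likewise for `E`). [folklore] -/
structure KLBox where
  /-- left end of the box -/
  mulo : ℚ
  /-- right end of the box -/
  muhi : ℚ
  /-- the `A1g` block -/
  bA1g : KLBlock
  /-- the `A2g` block -/
  bA2g : KLBlock
  /-- the `B1g` block -/
  bB1g : KLBlock
  /-- the `B2g` block -/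
  bB2g : KLBlock
  /-- the `E` block -/
  bE : KLBlock
  /-- row bound: `∫ χ₀(k+k')² dσ(k') ≤ R2` for `k` on the Fermi curve -/
  R2 : ℚ
  /-- threshold for the `B1g` trial amplitude `F_B(k)²` -/
  pB : ℚ
  /-- threshold for the `E` trial amplitudes `F_x(k)², F_y(k)²` -/
  pE : ℚ
  /-- rational `≥ √(R2 · kato_B)` -/
  r1B : ℚ
  /-- rational `≤ √(pB / Nhi_B)` -/
  r2B : ℚ
  /-- rational `≥ √(R2 · kato_E)` -/
  r1E : ℚ
  /-- rational `≤ √(pE / Nhi_E)` -/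
  r2E : ℚ

namespace KLBox

/-- The block of the channel `χ`. [folklore] -/
def blk (bx : KLBox) : D4Irrep → KLBlock
  | .A1g => bx.bA1g
  | .A2g => bx.bA2g
  | .B1g => bx.bB1g
  | .B2g => bx.bB2g
  | .E => bx.bE

/-- **The node-covering enclosures of a box** at the level `μ` (interface E5–E6): for every `k` on the Fermi
curve, `∫ χ₀(k+k')² dσ(k') ≤ R2`, and one of the trial amplitudes `F_B(k)², F_x(k)², F_y(k)²` clears its threshold,
where `F_Φ(k) = ∫ χ₀(k+k') Φ(k') dσ(k')`, `Φ_B, Φ_x` the `B1g`/`E` trials and `Φ_y = Φ_x ∘ rot³`. [folklore] -/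
def NodeEnclosure (bx : KLBox) (tab : List KLTrig) (μ : ℝ) : Prop :=
  ∀ k ∈ fermiCurve (squareDispersion 1 0) μ,
    ∫ k', lindhardFunction (squareDispersion 1 0) μ (k + k') ^ 2 ∂fermiCurveMeasure (squareDispersion 1 0) μ ≤
        (bx.R2 : ℝ) ∧
    ((bx.pB : ℝ) ≤ (∫ k', lindhardFunction (squareDispersion 1 0) μ (k + k') * bx.bB1g.trialFun tab k'
        ∂fermiCurveMeasure (squareDispersion 1 0) μ) ^ 2 ∨
     (bx.pE : ℝ) ≤ (∫ k', lindhardFunction (squareDispersion 1 0) μ (k + k') * bx.bE.trialFun tab k'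
        ∂fermiCurveMeasure (squareDispersion 1 0) μ) ^ 2 ∨
     (bx.pE : ℝ) ≤ (∫ k', lindhardFunction (squareDispersion 1 0) μ (k + k') *
        bx.bE.trialFun tab (rotMomentum (rotMomentum (rotMomentum k')))
        ∂fermiCurveMeasure (squareDispersion 1 0) μ) ^ 2)

/-- The box is well formed and every channel has a certified lower bound; `B1g` and `E` have Ritz data.
[folklore] -/
def basicOK (bx : KLBox) (tab : List KLTrig) : Bool :=
  decide (-4 < bx.mulo) && decide (bx.mulo ≤ bx.muhi) && decide (bx.muhi < 0) &&
    bx.bB1g.ritzOK tab .B1g && bx.bE.ritzOK tab .E && !bx.bB1g.withU && !bx.bE.withU &&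
    bx.bA1g.lowerOK tab .A1g && bx.bA2g.lowerOK tab .A2g && bx.bB1g.lowerOK tab .B1g &&
    bx.bB2g.lowerOK tab .B2g && bx.bE.lowerOK tab .E

/-- Two-channel isolation and negativity on the box (clauses N3, N4): `min (U_B1g, U_E) + γ ≤ L_χ` for the three
other channels, `U_B1g < 0`, `U_E < 0`. [folklore] -/
def isolationOK (bx : KLBox) (tab : List KLTrig) (γ : ℚ) : Bool :=
  decide (bx.bB1g.upper < 0) && decide (bx.bE.upper < 0) &&
    decide (min bx.bB1g.upper bx.bE.upper + γ ≤ bx.bA1g.lower tab .A1g) &&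
    decide (min bx.bB1g.upper bx.bE.upper + γ ≤ bx.bA2g.lower tab .A2g) &&
    decide (min bx.bB1g.upper bx.bE.upper + γ ≤ bx.bB2g.lower tab .B2g)

/-- `B1g` leads every other channel by `γ` (clause N1, used on the box containing `μ_a`). [folklore] -/
def b1gLeadsOK (bx : KLBox) (tab : List KLTrig) (γ : ℚ) : Bool :=
  decide (bx.bB1g.upper + γ ≤ bx.bA1g.lower tab .A1g) && decide (bx.bB1g.upper + γ ≤ bx.bA2g.lower tab .A2g) &&
    decide (bx.bB1g.upper + γ ≤ bx.bB2g.lower tab .B2g) && decide (bx.bB1g.upper + γ ≤ bx.bE.lower tab .E)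

/-- `E` leads every other channel by `γ` (clause N2, used on the box containing `μ_b`). [folklore] -/
def eLeadsOK (bx : KLBox) (tab : List KLTrig) (γ : ℚ) : Bool :=
  decide (bx.bE.upper + γ ≤ bx.bA1g.lower tab .A1g) && decide (bx.bE.upper + γ ≤ bx.bA2g.lower tab .A2g) &&
    decide (bx.bE.upper + γ ≤ bx.bB2g.lower tab .B2g) && decide (bx.bE.upper + γ ≤ bx.bB1g.lower tab .B1g)

/-- Node covering on the box (clause N5) with the constant `cov`: Temple data for `B1g` and `E`, simplicity of
the `B1g` bottom (`Hhi < 2ρhi²`) and exact doublet for `E` (`Hhi < 3ρhi²`), the square-root witnesses, and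
`cov · L² ≤ (r2 - r1)²` with `r2 - r1 > 0` for both channels. [folklore] -/
def nodeOK (bx : KLBox) (tab : List KLTrig) (cov : ℚ) : Bool :=
  bx.bB1g.templeOK tab .B1g && bx.bE.templeOK tab .E &&
    decide (bx.bB1g.Hhi < 2 * bx.bB1g.rhohi ^ 2) && decide (bx.bE.Hhi < 3 * bx.bE.rhohi ^ 2) &&
    decide (0 ≤ bx.R2) && decide (0 < bx.pB) && decide (0 < bx.pE) &&
    decide (0 ≤ bx.bB1g.kato) && decide (0 ≤ bx.bE.kato) &&
    decide (0 ≤ bx.r1B) && decide (bx.R2 * bx.bB1g.kato ≤ bx.r1B ^ 2) &&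
    decide (0 ≤ bx.r2B) && decide (bx.r2B ^ 2 * bx.bB1g.Nhi ≤ bx.pB) && decide (bx.r1B < bx.r2B) &&
    decide (0 ≤ bx.r1E) && decide (bx.R2 * bx.bE.kato ≤ bx.r1E ^ 2) &&
    decide (0 ≤ bx.r2E) && decide (bx.r2E ^ 2 * bx.bE.Nhi ≤ bx.pE) && decide (bx.r1E < bx.r2E) &&
    decide (cov * (bx.bB1g.lower tab .B1g) ^ 2 ≤ (bx.r2B - bx.r1B) ^ 2) &&
    decide (cov * (bx.bE.lower tab .E) ^ 2 ≤ (bx.r2E - bx.r1E) ^ 2)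

end KLBox

/-- The whole record: window ends `mua > mub`, margin `gamma`, node-covering constant `cov`, and the boxes
(sorted, contiguous, covering `[mub, mua]`). [folklore] -/
structure KLCert where
  /-- `μ_a` (the `B1g` end, larger chemical potential = smaller hole doping) -/
  mua : ℚ
  /-- `μ_b` (the `E` end) -/
  mub : ℚ
  /-- the margin `γ > 0` -/
  gamma : ℚ
  /-- the node-covering constant `c > 0` -/
  cov : ℚ
  /-- the table of trigonometric polynomials (trials and deflation vectors refer to it by index) -/
  trials : List KLTrig
  /-- the boxes -/
  boxes : List KLBox

namespace KLCert

/-- **The named numerical hypothesis (enclosures E0–E6).** The fillings at the two window ends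
(`n(μ_a) ≤ 7/10`, `13/25 ≤ n(μ_b)`), and on every box, uniformly in `μ`, the block enclosures of the five channels and
the node-covering enclosures.  Every conjunct is an inequality between an explicit integral against the tree's
measures (`fermiCurveMeasure`, Lebesgue) and a rational of the record — the object of the certified
interval-arithmetic computation. [folklore] -/
def Enclosures (c : KLCert) : Prop :=
  KohnLuttinger.filling (squareDispersion 1 0) (c.mua : ℝ) ≤ 7 / 10 ∧
    (13 / 25 : ℝ) ≤ KohnLuttinger.filling (squareDispersion 1 0) (c.mub : ℝ) ∧
    ∀ bx ∈ c.boxes, ∀ μ ∈ Set.Icc (bx.mulo : ℝ) (bx.muhi : ℝ),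
      (∀ χ : D4Irrep, (bx.blk χ).Enclosure c.trials μ χ) ∧ bx.NodeEnclosure c.trials μ

/-- The boxes are contiguous: consecutive boxes overlap or touch. [folklore] -/
def chainOK : List KLBox → Bool
  | [] => true
  | [_] => true
  | b₁ :: b₂ :: rest => decide (b₂.mulo ≤ b₁.muhi) && chainOK (b₂ :: rest)

/-- **The checker.** Window ends in `(-4, 0)` with `mub < mua`, `gamma > 0`, `cov > 0`; boxes non-empty,
well formed, contiguous and covering `[mub, mua]`; on every box isolation/negativity (N3, N4) and node covering
(N5); `B1g` leads on some box containing `mua` (N1) and `E` leads on some box containing `mub` (N2). [folklore] -/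
def check (c : KLCert) : Bool :=
  decide (-4 < c.mub) && decide (c.mub < c.mua) && decide (c.mua < 0) && decide (0 < c.gamma) &&
    decide (0 < c.cov) &&
    (match c.boxes.head?, c.boxes.getLast? with
      | some b₀, some b₁ => decide (b₀.mulo ≤ c.mub) && decide (c.mua ≤ b₁.muhi)
      | _, _ => false) &&
    chainOK c.boxes &&
    (c.boxes.all fun bx => bx.basicOK c.trials && bx.isolationOK c.trials c.gamma && bx.nodeOK c.trials c.cov) &&
    (c.boxes.any fun bx =>
      decide (bx.mulo ≤ c.mua) && decide (c.mua ≤ bx.muhi) && bx.b1gLeadsOK c.trials c.gamma) &&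
    (c.boxes.any fun bx =>
      decide (bx.mulo ≤ c.mub) && decide (c.mub ≤ bx.muhi) && bx.eLeadsOK c.trials c.gamma)

end KLCert

/-- The trigonometric gap functions vanish at the origin (the documented device of `KLTrig.toFun`). [folklore] -/
theorem klTrig_toFun_zero : ∀ t : KLTrig, KLTrig.toFun t 0 = 0 := by
  intro t
  simp [KLTrig.toFun]

end Summit.HubbardSuperconductivity.HubbardSuperconductivity.Theorems.CwKLChiralWindow

end
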